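import Summits.RiemannHypothesis.RiemannHypothesis.Theses.SignCone
import Summits.RiemannHypothesis.RiemannHypothesis.Theorems.SignConeConeMagnificationCompactness
import Literature.NumberTheory.LFunctions.WeilExplicit
import Literature.NumberTheory.LFunctions.GeneralizedRH
import Summits.RiemannHypothesis.RiemannHypothesis.Theorems.SignConeConeMagnificationKernel
import Summits.RiemannHypothesis.RiemannHypothesis.Theorems.SignConeExactConeRigidityCaratheodoryDirichlet

/-!
# Stub `stub_cara` of line `Sketch` for crux `SignCone.ConeMagnification` — tools (Aux file 1 of 2)
(item stmt-RiemannHypothesis-16303, route route-RiemannHypothesis-SignCone; `--supports`, registered sub-goal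
`stub_caraGlue`)

Inputs of the Carathéodory description (archive 2001 swcm "Thm A♭", necessity) of a unit-slack weight `c ≥ 0`,
consumed by `…StubCara.lean`:
* `stub_caraGlue` — GLUING of the local continuations of `L_c − 1/(s−1)` on rectangles to ONE holomorphic `F`
  on `Re s > 1/2` (identity theorem on convex overlaps);
* `re_mul_weilMellin_add_dslope_le` — the WINDOW INEQUALITY
  `Re (F(z+½) M_G(z+½) + dslope M_G 1 (z+½)) ≤ Re (M_G(0)/(z+½) + 𝓐_G(z) + 𝓖_G(z) − Fin(z))` for every
  `Re z > 0` (`G = g ⋆ g̃`, `𝓐_G(z) = ∫₀^∞ W_∞(G(·−x)) e^{-zx} dx`, `𝓖_G(z) = ∫₀^∞ G(−x) e^{-zx} dx`): the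
  continuation identity `SignCone.LSeries_mul_weilMellin_sub_pole_eq` extended to the half-plane
  (`SignCone.differentiableOn_contRHS`, identity theorem) plus the Laplace positivity of `stub_pdLaplace`;
* `finCorrection_eq_zero` (windows of radius `≤ 1/4` see no node), `weilConv_weilReflect_bump` (real bumps:
  `G ≥ 0`, mass `∫ G = ‖ĝ(½)‖² > 0`), `tendsto_integral_mul_div` (approximate identity `∫ G_k φ / ∫ G_k → φ(0)`).
-/

noncomputable section

-- `Summit.RiemannHypothesis.RiemannHypothesis.…` repeats a namespace component by design (D-0017 layout).
set_option linter.dupNamespace false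

open scoped BigOperators ComplexConjugate Topology
open Complex MeasureTheory Set Filter

namespace Summit.RiemannHypothesis.RiemannHypothesis.Theorems.SignConeConeMagnification

open Literature.NumberTheory.LFunctions
open Summit.RiemannHypothesis.RiemannHypothesis.Theorems.SignCone
open Summit.RiemannHypothesis.RiemannHypothesis.Theorems.SignConeExactConeRigidity

/-! ## Gluing the rectangles -/

/-- The rectangle `(1/2, Re s₀ + 1) × (Im s₀ - η, Im s₀ + η)` is open and convex. [folklore] -/
theorem isOpen_convex_caraRect (s₀ : ℂ) (η : ℝ) :
    IsOpen {s : ℂ | 1 / 2 < s.re ∧ s.re < s₀.re + 1 ∧ s₀.im - η < s.im ∧ s.im < s₀.im + η} ∧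
      Convex ℝ {s : ℂ | 1 / 2 < s.re ∧ s.re < s₀.re + 1 ∧ s₀.im - η < s.im ∧ s.im < s₀.im + η} := by
  have e : {s : ℂ | 1 / 2 < s.re ∧ s.re < s₀.re + 1 ∧ s₀.im - η < s.im ∧ s.im < s₀.im + η} =
      {s : ℂ | 1 / 2 < s.re} ∩ ({s : ℂ | s.re < s₀.re + 1} ∩
        ({s : ℂ | s₀.im - η < s.im} ∩ {s : ℂ | s.im < s₀.im + η})) := by
    ext s; simp only [mem_setOf_eq, mem_inter_iff]
  rw [e]
  exact ⟨(isOpen_lt continuous_const continuous_re).inter ((isOpen_lt continuous_re continuous_const).inter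
      ((isOpen_lt continuous_const continuous_im).inter (isOpen_lt continuous_im continuous_const))),
    (convex_halfSpace_re_gt _).inter ((convex_halfSpace_re_lt _).inter
      ((convex_halfSpace_im_gt _).inter (convex_halfSpace_im_lt _)))⟩

/-- **Registered sub-goal `stub_caraGlue` — gluing local continuations.** Holomorphic `F_{s₀}` on the rectangles
`R(s₀) = (1/2, Re s₀ + 1) × (Im s₀ - η, Im s₀ + η)` (`Re s₀ > 1/2`), each equal to `L` on `R(s₀) ∩ {Re s > 1}`,
patch to ONE holomorphic `F` on `Re s > 1/2` equal to `L` on `Re s > 1`: two of them agree on the overlap of their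
rectangles (open, convex, meeting `Re s > 1` in an open set: identity theorem), so `F(s) := F_s(s)` works. [folklore] -/
theorem stub_caraGlue :
    ∀ L : ℂ → ℂ, (∀ s₀ : ℂ, 1 / 2 < s₀.re → ∃ η : ℝ, 0 < η ∧ ∃ F : ℂ → ℂ,
        DifferentiableOn ℂ F {s : ℂ | 1 / 2 < s.re ∧ s.re < s₀.re + 1 ∧ s₀.im - η < s.im ∧ s.im < s₀.im + η} ∧
        ∀ s ∈ {s : ℂ | 1 / 2 < s.re ∧ s.re < s₀.re + 1 ∧ s₀.im - η < s.im ∧ s.im < s₀.im + η},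
          1 < s.re → F s = L s) →
      ∃ F : ℂ → ℂ, DifferentiableOn ℂ F {s : ℂ | 1 / 2 < s.re} ∧ ∀ s : ℂ, 1 < s.re → F s = L s := by
  intro L hR
  choose! η hη F hFd hFL using hR
  set R : ℂ → Set ℂ := fun s₀ =>
    {s : ℂ | 1 / 2 < s.re ∧ s.re < s₀.re + 1 ∧ s₀.im - η s₀ < s.im ∧ s.im < s₀.im + η s₀} with hRdef
  have hmem : ∀ s₀ : ℂ, 1 / 2 < s₀.re → s₀ ∈ R s₀ := fun s₀ h =>
    ⟨h, by linarith, by linarith [hη s₀ h], by linarith [hη s₀ h]⟩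
  have hopen : ∀ s₀, IsOpen (R s₀) := fun s₀ => (isOpen_convex_caraRect s₀ (η s₀)).1
  -- compatibility on overlaps (identity theorem)
  have hcompat : ∀ s₁ s₂ : ℂ, 1 / 2 < s₁.re → 1 / 2 < s₂.re → ∀ s ∈ R s₁ ∩ R s₂, F s₁ s = F s₂ s := by
    intro s₁ s₂ h₁ h₂ s hs
    have hVo : IsOpen (R s₁ ∩ R s₂) := (hopen s₁).inter (hopen s₂)
    have hVc : IsPreconnected (R s₁ ∩ R s₂) :=
      ((isOpen_convex_caraRect s₁ (η s₁)).2.inter (isOpen_convex_caraRect s₂ (η s₂)).2).isPreconnected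
    set m : ℝ := min s₁.re s₂.re with hm
    have hm0 : 1 / 2 < m := lt_min h₁ h₂
    have hm12 : m ≤ s₁.re ∧ m ≤ s₂.re := ⟨min_le_left _ _, min_le_right _ _⟩
    set z₀ : ℂ := ⟨m / 2 + 1, s.im⟩ with hz₀
    have hs' := hs
    obtain ⟨⟨-, -, h1a, h1b⟩, ⟨-, -, h2a, h2b⟩⟩ := hs'
    have hz₀V : z₀ ∈ R s₁ ∩ R s₂ :=
      ⟨⟨show (1 : ℝ) / 2 < m / 2 + 1 by linarith, show m / 2 + 1 < s₁.re + 1 by linarith [hm12.1], h1a, h1b⟩,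
        ⟨show (1 : ℝ) / 2 < m / 2 + 1 by linarith, show m / 2 + 1 < s₂.re + 1 by linarith [hm12.2], h2a, h2b⟩⟩
    have hz₀1 : (1 : ℝ) < z₀.re := show (1 : ℝ) < m / 2 + 1 by linarith
    have hev : F s₁ =ᶠ[𝓝 z₀] F s₂ := by
      have hO : IsOpen ((R s₁ ∩ R s₂) ∩ {w : ℂ | 1 < w.re}) :=
        hVo.inter (isOpen_lt continuous_const continuous_re)
      filter_upwards [hO.mem_nhds ⟨hz₀V, hz₀1⟩] with w hw
      rw [hFL s₁ h₁ w hw.1.1 hw.2, hFL s₂ h₂ w hw.1.2 hw.2]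
    have hA₁ : AnalyticOnNhd ℂ (F s₁) (R s₁ ∩ R s₂) :=
      ((hFd s₁ h₁).mono inter_subset_left).analyticOnNhd hVo
    have hA₂ : AnalyticOnNhd ℂ (F s₂) (R s₁ ∩ R s₂) :=
      ((hFd s₂ h₂).mono inter_subset_right).analyticOnNhd hVo
    exact hA₁.eqOn_of_preconnected_of_eventuallyEq hA₂ hVc hz₀V hev hs
  refine ⟨fun s => F s s, fun s₁ hs₁ => ?_, fun s hs => hFL s (by linarith) s (hmem s (by linarith)) hs⟩
  have hs₁' : (1 : ℝ) / 2 < s₁.re := hs₁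
  have hev : (fun s => F s s) =ᶠ[𝓝 s₁] F s₁ := by
    filter_upwards [(hopen s₁).mem_nhds (hmem s₁ hs₁')] with s hs
    exact hcompat s s₁ hs.1 hs₁' s ⟨hmem s hs.1, hs⟩
  have hd : DifferentiableAt ℂ (F s₁) s₁ :=
    (hFd s₁ hs₁').differentiableAt ((hopen s₁).mem_nhds (hmem s₁ hs₁'))
  exact (hd.congr_of_eventuallyEq hev).differentiableWithinAt

/-! ## The window inequality on the half-plane `Re z > 0` -/

variable {g : ℝ → ℂ} {a : ℝ} {c : ℕ → ℝ}

/-- **The window inequality on the whole half-plane.** Let `c ≥ 0` have unit slack against every Weil test,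
`Σ c(n) n^{-σ} < ∞` (`σ > 1`), the Laplace positivity of `stub_pdLaplace`, and let `F` be holomorphic on
`Re s > 1/2` with `F = L_c - 1/(s-1)` on `Re s > 1`. For a Weil test `g` with `tsupport g ⊆ [-a, a]` (`a ≥ 0`),
`G = g ⋆ g̃`, `M_G = weilMellin G` and `Re z > 0`:
`Re (F(z+½) M_G(z+½) + dslope M_G 1 (z+½)) ≤ Re (M_G(0)/(z+½) + 𝓐_G(z) + 𝓖_G(z) - Fin(z))`
(the continuation identity, extended from `Re z > 1/2` by the identity theorem, plus the Laplace positivity after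
the split `a(x) = e^{-x/2} M_G(0) + W_∞(G(·-x)) - u(x) + G(-x)`). [folklore] -/
theorem re_mul_weilMellin_add_dslope_le
    (hU : ∀ φ : ℝ → ℂ, IsWeilTest φ →
      -(∫ t, ‖φ t‖ ^ 2) ≤
        (weilPolarTerm (weilConv φ (weilReflect φ)) + weilArchTerm (weilConv φ (weilReflect φ)) -
          ∑' n : ℕ, ((c n : ℝ) : ℂ) / (Real.sqrt n : ℂ) *
            (weilConv φ (weilReflect φ) (Real.log n) + weilConv φ (weilReflect φ) (-Real.log n))).re)
    (hc : ∀ n, 0 ≤ c n) (hsum : ∀ σ : ℝ, 1 < σ → LSeriesSummable (fun n => ((c n : ℝ) : ℂ)) σ)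
    (hPD : ∀ φ : ℝ → ℂ, IsWeilTest φ → ∀ z : ℂ, 0 < z.re →
        0 ≤ (∫ x in Set.Ioi (0 : ℝ),
          (weilTranslate (weilConv φ (weilReflect φ)) x 0 +
              weilPolarTerm (weilTranslate (weilConv φ (weilReflect φ)) x) +
              weilArchTerm (weilTranslate (weilConv φ (weilReflect φ)) x) -
              ∑' n : ℕ, ((c n : ℝ) : ℂ) / (Real.sqrt n : ℂ) *
                (weilTranslate (weilConv φ (weilReflect φ)) x (Real.log n) +
                  weilTranslate (weilConv φ (weilReflect φ)) x (-Real.log n))) *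
            Complex.exp (-(z * x))).re)
    {F : ℂ → ℂ} (hFd : DifferentiableOn ℂ F {s : ℂ | 1 / 2 < s.re})
    (hFL : ∀ s : ℂ, 1 < s.re → F s = LSeries (fun n => ((c n : ℝ) : ℂ)) s - 1 / (s - 1))
    (hg : IsWeilTest g) (ha : 0 ≤ a) (hsupp : tsupport g ⊆ Icc (-a) a) {z : ℂ} (hz : 0 < z.re) :
    (F (z + 1 / 2) * weilMellin (weilConv g (weilReflect g)) (z + 1 / 2) +
        dslope (weilMellin (weilConv g (weilReflect g))) 1 (z + 1 / 2)).re ≤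
      (weilMellin (weilConv g (weilReflect g)) 0 / (z + 1 / 2) +
        (∫ x in Ioi (0 : ℝ), weilArchTerm (weilTranslate (weilConv g (weilReflect g)) x) * cexp (-(z * x))) +
        (∫ x in Ioi (0 : ℝ), weilConv g (weilReflect g) (-x) * cexp (-(z * x))) -
        ∑ n ∈ Finset.range (⌊Real.exp (2 * a)⌋₊ + 1), ((c n : ℝ) : ℂ) / (Real.sqrt n : ℂ) *
          ((∫ x in Ioi (0 : ℝ), (weilConv g (weilReflect g) (Real.log n - x) +
              weilConv g (weilReflect g) (-Real.log n - x)) * cexp (-(z * x))) -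
            cexp (-(z * Real.log n)) * weilMellin (weilConv g (weilReflect g)) (z + 1 / 2))).re := by
  set G : ℝ → ℂ := weilConv g (weilReflect g) with hG
  have hGt : IsWeilTest G := hg.weilConv hg.weilReflect
  obtain ⟨M, hM⟩ := hGt.1.continuous.bounded_above_of_compact_support hGt.2
  set MG : ℂ → ℂ := weilMellin G with hMG
  have hMGd : Differentiable ℂ MG := differentiable_weilMellin hGt.1.continuous hGt.2
  set N : ℕ := ⌊Real.exp (2 * a)⌋₊ + 1 with hN
  -- `u(x) = P_c(G(· - x)) - e^{x/2} M_G(1)`, the finite correction and the right-hand side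
  set u : ℝ → ℂ := fun x => (∑' n : ℕ, ((c n : ℝ) : ℂ) / (Real.sqrt n : ℂ) *
      (G (Real.log n - x) + G (-Real.log n - x))) - cexp ((x : ℂ) / 2) * MG 1 with hu
  set Fin : ℂ → ℂ := fun w => ∑ n ∈ Finset.range N, ((c n : ℝ) : ℂ) / (Real.sqrt n : ℂ) *
      ((∫ x in Ioi (0 : ℝ), (G (Real.log n - x) + G (-Real.log n - x)) * cexp (-(w * x))) -
        cexp (-(w * Real.log n)) * MG (w + 1 / 2)) with hFin
  set RHS : ℂ → ℂ := fun w => (∫ x in Ioi (0 : ℝ), u x * cexp (-(w * x))) - Fin w with hRHS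
  have hRHSd : DifferentiableOn ℂ RHS {w : ℂ | 0 < w.re} := differentiableOn_contRHS hU hg hsupp N
  -- STEP (I): the continued identity `F(w+½) M_G(w+½) + dslope M_G 1 (w+½) = RHS w` on `Re w > 0`
  have hDs : Differentiable ℂ (dslope MG 1) := by
    intro s
    rcases eq_or_ne s 1 with rfl | hs
    · obtain ⟨p, hp⟩ := hMGd.analyticAt 1
      exact hp.has_fpower_series_dslope_fslope.analyticAt.differentiableAt
    · exact (differentiableAt_dslope_of_ne hs).2 (hMGd s)
  set Φ : ℂ → ℂ := fun w => F (w + 1 / 2) * MG (w + 1 / 2) + dslope MG 1 (w + 1 / 2) - RHS w with hΦ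
  have hΦd : DifferentiableOn ℂ Φ {w : ℂ | 0 < w.re} := by
    refine DifferentiableOn.sub (DifferentiableOn.add (DifferentiableOn.mul ?_ ?_) ?_) hRHSd
    · refine hFd.comp (by fun_prop) fun w hw => ?_
      show 1 / 2 < (w + 1 / 2).re
      have : 0 < w.re := hw
      simp; linarith
    · exact (hMGd.comp (differentiable_id.add_const _)).differentiableOn
    · exact (hDs.comp (differentiable_id.add_const _)).differentiableOn
  have hΦ0 : ∀ w : ℂ, 1 / 2 < w.re → Φ w = 0 := by
    intro w hw
    have hw1 : 1 < (w + 1 / 2).re := by simp; linarith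
    have hsum' : LSeriesSummable (fun n => ((c n : ℝ) : ℂ)) ((w.re + 1 / 2 : ℝ) : ℂ) := by
      have h := hsum (w.re + 1 / 2) (by linarith)
      exact_mod_cast h
    have hid := LSeries_mul_weilMellin_sub_pole_eq hU hc hg ha hsupp hw hsum'
    have hne : w + 1 / 2 ≠ 1 := by
      intro h; have := congrArg Complex.re h; simp at this; linarith
    have hne' : w - 1 / 2 ≠ 0 := by
      intro h; have := congrArg Complex.re h; simp at this; linarith
    have hdsl : dslope MG 1 (w + 1 / 2) = (MG (w + 1 / 2) - MG 1) / (w - 1 / 2) := by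
      rw [dslope_of_ne _ hne, slope_def_field]
      congr 1; ring
    have e : w + 1 / 2 - 1 = w - 1 / 2 := by ring
    simp only [hΦ, hRHS, hFin, hu, hMG, hG]
    rw [← hid, hFL _ hw1, hdsl, e]
    field_simp
    ring
  have hΦz : Φ z = 0 := by
    have hA : AnalyticOnNhd ℂ Φ {w : ℂ | 0 < w.re} :=
      hΦd.analyticOnNhd (isOpen_lt continuous_const continuous_re)
    have hev : Φ =ᶠ[𝓝 (1 : ℂ)] 0 := by
      filter_upwards [(isOpen_lt continuous_const continuous_re).mem_nhds
        (show (1 / 2 : ℝ) < (1 : ℂ).re by norm_num)] with w hw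
      exact hΦ0 w hw
    exact hA.eqOn_zero_of_preconnected_of_eventuallyEq_zero (convex_halfSpace_re_gt 0).isPreconnected
      (show (0 : ℝ) < (1 : ℂ).re by simp) hev hz
  -- STEP (II): the pieces of `a(x) e^{-zx}` and their integrability on `(0, ∞)`
  set f₀ : ℝ → ℂ := fun x => cexp (-((x : ℂ) / 2)) * MG 0 * cexp (-(z * x)) with hf₀
  set fA : ℝ → ℂ := fun x => weilArchTerm (weilTranslate G x) * cexp (-(z * x)) with hfA
  set fu : ℝ → ℂ := fun x => u x * cexp (-(z * x)) with hfu
  set fG : ℝ → ℂ := fun x => G (-x) * cexp (-(z * x)) with hfG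
  have hi₀ : IntegrableOn f₀ (Ioi 0) := by
    have ha' : ((-(1 / 2) : ℂ) - z).re < 0 := by
      simp only [sub_re, neg_re, one_div]; norm_num; linarith
    have h : IntegrableOn (fun x : ℝ => cexp ((-(1 / 2) - z) * x) * MG 0) (Ioi 0) :=
      (integrableOn_exp_mul_complex_Ioi ha' 0).mul_const _
    refine h.congr_fun (fun x _ => ?_) measurableSet_Ioi
    show cexp ((-(1 / 2) - z) * x) * MG 0 = cexp (-((x : ℂ) / 2)) * MG 0 * cexp (-(z * x))
    rw [show ((-(1 / 2) : ℂ) - z) * x = -((x : ℂ) / 2) + -(z * x) by ring, Complex.exp_add]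
    ring
  have hiA : IntegrableOn fA (Ioi 0) := by
    refine integrableOn_mul_exp_of_bounded (continuous_weilArchTerm_weilTranslate hGt)
      (C := 1 / (2 * Real.pi) * (∫ t : ℝ, ‖weilMellin G (1 / 2 + t * I) *
        ((Complex.digamma (1 / 4 + t / 2 * I)).re : ℂ)‖) + M * Real.log Real.pi) (fun x _ => ?_) hz
    refine (norm_weilArchTerm_weilTranslate_le hGt x).trans (add_le_add le_rfl ?_)
    exact mul_le_mul_of_nonneg_right (hM _) (Real.log_nonneg (by linarith [Real.pi_gt_three]))
  have hiu : IntegrableOn fu (Ioi 0) :=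
    integrableOn_mul_exp_of_bounded (@continuous_fakeSum_translate_sub g a hg hsupp c)
      (fun x hx => @norm_fakeSum_translate_sub_le g c hU hg M hM x hx) hz
  have hiG : IntegrableOn fG (Ioi 0) :=
    integrableOn_mul_exp_of_bounded (hGt.1.continuous.comp continuous_neg) (C := M) (fun x _ => hM _) hz
  -- the pointwise decomposition of the integrand of `stub_pdLaplace`
  have hdecomp : ∀ x : ℝ,
      (weilTranslate G x 0 + weilPolarTerm (weilTranslate G x) + weilArchTerm (weilTranslate G x) -
          (∑' n : ℕ, ((c n : ℝ) : ℂ) / (Real.sqrt n : ℂ) *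
            (weilTranslate G x (Real.log n) + weilTranslate G x (-Real.log n)))) * cexp (-(z * x)) =
      f₀ x + fA x - fu x + fG x := by
    intro x
    simp only [hf₀, hfA, hfu, hfG, hu, weilPolarTerm_weilTranslate, weilTranslate, zero_sub]
    ring
  have hL := hPD g hg z hz
  have hcongr : (∫ x in Ioi (0 : ℝ),
      (weilTranslate G x 0 + weilPolarTerm (weilTranslate G x) + weilArchTerm (weilTranslate G x) -
          (∑' n : ℕ, ((c n : ℝ) : ℂ) / (Real.sqrt n : ℂ) *
            (weilTranslate G x (Real.log n) + weilTranslate G x (-Real.log n)))) * cexp (-(z * x))) =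
      ∫ x in Ioi (0 : ℝ), (f₀ x + fA x - fu x + fG x) :=
    integral_congr_ae ((ae_restrict_iff' measurableSet_Ioi).2 (Eventually.of_forall fun x _ => hdecomp x))
  have hs1 : (∫ x in Ioi (0 : ℝ), (f₀ x + fA x - fu x + fG x)) =
      (∫ x in Ioi (0 : ℝ), (f₀ x + fA x - fu x)) + ∫ x in Ioi (0 : ℝ), fG x :=
    integral_add ((hi₀.add hiA).sub hiu) hiG
  have hs2 : (∫ x in Ioi (0 : ℝ), (f₀ x + fA x - fu x)) =
      (∫ x in Ioi (0 : ℝ), (f₀ x + fA x)) - ∫ x in Ioi (0 : ℝ), fu x :=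
    integral_sub (hi₀.add hiA) hiu
  have hs3 : (∫ x in Ioi (0 : ℝ), (f₀ x + fA x)) = (∫ x in Ioi (0 : ℝ), f₀ x) + ∫ x in Ioi (0 : ℝ), fA x :=
    integral_add hi₀ hiA
  have hI₀ : (∫ x in Ioi (0 : ℝ), f₀ x) = MG 0 / (z + 1 / 2) := by
    have e : f₀ = fun x : ℝ => MG 0 * (cexp (-((x : ℂ) / 2)) * cexp (-(z * x))) := by
      funext x; simp only [hf₀]; ring
    rw [e, integral_const_mul, integral_exp_neg_half_laplace (by linarith)]
    ring
  rw [hcongr, hs1, hs2, hs3, hI₀] at hL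
  -- assemble
  have h1 := congrArg Complex.re hΦz
  simp only [hΦ, hRHS, Complex.sub_re, Complex.add_re, Complex.zero_re] at hL h1 ⊢
  linarith

/-! ## Narrow windows, real bumps, approximate identities -/

/-- For a window of radius `a ≤ 1/4` only the nodes `n = 0, 1` enter the finite correction (`⌊e^{2a}⌋ = 1`), and
both carry the weight `c(n)/√n = 0` (`√0 = 0`, `c 1 = 0`). [folklore] -/
theorem finCorrection_eq_zero (hc1 : c 1 = 0) (ha0 : 0 ≤ a) (ha : a ≤ 1 / 4) (T : ℕ → ℂ) :
    ∑ n ∈ Finset.range (⌊Real.exp (2 * a)⌋₊ + 1), ((c n : ℝ) : ℂ) / (Real.sqrt n : ℂ) * T n = 0 := by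
  have hfl : ⌊Real.exp (2 * a)⌋₊ = 1 := by
    rw [Nat.floor_eq_iff (Real.exp_pos _).le]
    refine ⟨by simpa using Real.one_le_exp (by linarith : (0 : ℝ) ≤ 2 * a), ?_⟩
    have h1 : Real.exp (2 * a) ≤ Real.exp (1 / 2) := Real.exp_le_exp.2 (by linarith)
    have h2 : Real.exp (1 / 2) < 2 := by
      have h3 : Real.exp (1 / 2) ^ 2 < 2 ^ 2 := by
        rw [← Real.exp_nat_mul]
        norm_num
        linarith [Real.exp_one_lt_d9]
      exact lt_of_pow_lt_pow_left₀ 2 (by norm_num) h3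
    push_cast
    linarith
  rw [hfl]
  simp [Finset.sum_range_succ, hc1]

/-- **Real bumps.** For a smooth bump `b` at `0` of outer radius `r`, the real test `g = b` is a Weil test with
`tsupport g ⊆ [-r, r]`; its autocorrelation `G = g ⋆ g̃` is pointwise `≥ 0` (so `G = ‖G‖`), vanishes off
`[-2r, 2r]`, and has mass `∫ ‖G‖ = ‖ĝ(1/2)‖² = (∫ b)² > 0`. [folklore] -/
theorem weilConv_weilReflect_bump (b : ContDiffBump (0 : ℝ)) :
    IsWeilTest (fun u => ((b u : ℝ) : ℂ)) ∧ tsupport (fun u => ((b u : ℝ) : ℂ)) ⊆ Icc (-b.rOut) b.rOut ∧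
      (∀ t, weilConv (fun u => ((b u : ℝ) : ℂ)) (weilReflect fun u => ((b u : ℝ) : ℂ)) t =
        ((‖weilConv (fun u => ((b u : ℝ) : ℂ)) (weilReflect fun u => ((b u : ℝ) : ℂ)) t‖ : ℝ) : ℂ)) ∧
      (∀ t, 2 * b.rOut < |t| →
        weilConv (fun u => ((b u : ℝ) : ℂ)) (weilReflect fun u => ((b u : ℝ) : ℂ)) t = 0) ∧
      0 < ∫ t, ‖weilConv (fun u => ((b u : ℝ) : ℂ)) (weilReflect fun u => ((b u : ℝ) : ℂ)) t‖ := by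
  set g : ℝ → ℂ := fun u => ((b u : ℝ) : ℂ) with hg
  have hgW : IsWeilTest g :=
    ⟨ofRealCLM.contDiff.comp b.contDiff, b.hasCompactSupport.comp_left (g := ((↑) : ℝ → ℂ)) Complex.ofReal_zero⟩
  have hsupp : tsupport g ⊆ Icc (-b.rOut) b.rOut := by
    refine (tsupport_comp_subset (g := ((↑) : ℝ → ℂ)) Complex.ofReal_zero b).trans ?_
    rw [b.tsupport_eq, Real.closedBall_eq_Icc, zero_sub, zero_add]
  set G := weilConv g (weilReflect g) with hG
  have hGreal : ∀ t, G t = ((∫ u, b u * b (u - t) : ℝ) : ℂ) := by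
    intro t
    rw [hG, weilConv_apply, ← integral_complex_ofReal]
    congr 1 with u
    simp only [hg, weilReflect, Complex.conj_ofReal, neg_sub]
    push_cast
    ring
  have hGnn : ∀ t, 0 ≤ ∫ u, b u * b (u - t) := fun t =>
    integral_nonneg fun u => mul_nonneg b.nonneg b.nonneg
  have hGn : ∀ t, G t = ((‖G t‖ : ℝ) : ℂ) := by
    intro t; rw [hGreal t, Complex.norm_real, Real.norm_of_nonneg (hGnn t)]
  refine ⟨hgW, hsupp, hGn, fun t ht =>
    Literature.NumberTheory.LFunctions.weilConv_weilReflect_eq_zero_of_le_abs hgW hsupp ht.le, ?_⟩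
  have h1 : ((∫ t, ‖G t‖ : ℝ) : ℂ) = weilMellin G (1 / 2) := by
    rw [weilMellin, ← integral_complex_ofReal]
    congr 1 with t
    rw [← hGn t]
    simp
  have h2 : weilMellin G (1 / 2) = ((‖weilMellin g (1 / 2)‖ ^ 2 : ℝ) : ℂ) := by
    simpa using weilMellin_weilConv_weilReflect_half hgW 0
  have h3 : weilMellin g (1 / 2) = ((∫ u, b u : ℝ) : ℂ) := by
    rw [weilMellin, ← integral_complex_ofReal]
    congr 1 with u
    simp [hg]
  have h4 : (∫ t, ‖G t‖) = ‖weilMellin g (1 / 2)‖ ^ 2 := by exact_mod_cast h1.trans h2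
  rw [h4, h3, Complex.norm_real, Real.norm_of_nonneg (integral_nonneg fun u => b.nonneg)]
  exact pow_pos b.integral_pos 2

/-- **Approximate identity.** If `G_k ≥ 0` are continuous, vanish off `[-δ_k, δ_k]` with `δ_k → 0`, and have
mass `m_k = ∫ G_k > 0`, then `(∫ G_k φ)/m_k → φ(0)` for every continuous `φ`. [folklore] -/
theorem tendsto_integral_mul_div {G : ℕ → ℝ → ℂ} {δ : ℕ → ℝ} (hδ : Tendsto δ atTop (𝓝 0))
    (hGc : ∀ k, Continuous (G k)) (hGδ : ∀ k u, δ k < |u| → G k u = 0)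
    (hGn : ∀ k u, G k u = ((‖G k u‖ : ℝ) : ℂ)) (hm : ∀ k, 0 < ∫ u, ‖G k u‖)
    {φ : ℝ → ℂ} (hφ : Continuous φ) :
    Tendsto (fun k => (∫ u, G k u * φ u) / ((∫ u, ‖G k u‖ : ℝ) : ℂ)) atTop (𝓝 (φ 0)) := by
  rw [Metric.tendsto_atTop]
  intro ε hε
  obtain ⟨η, hη, hηφ⟩ := Metric.continuous_iff.1 hφ 0 (ε / 2) (half_pos hε)
  obtain ⟨K, hK⟩ := Metric.tendsto_atTop.1 hδ η hη
  refine ⟨K, fun k hk => ?_⟩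
  have hδk : δ k < η := by
    have h := hK k hk
    rw [Real.dist_eq, sub_zero] at h
    exact (le_abs_self _).trans_lt h
  have hGs : HasCompactSupport (G k) := by
    refine HasCompactSupport.of_support_subset_isCompact (isCompact_Icc (a := -|δ k|) (b := |δ k|))
      fun u hu => ?_
    by_contra h
    refine hu (hGδ k u ?_)
    rw [mem_Icc, not_and_or, not_le, not_le] at h
    rcases h with h | h
    · linarith [le_abs_self (δ k), neg_abs_le u]
    · linarith [le_abs_self (δ k), le_abs_self u]
  set mk : ℝ := ∫ u, ‖G k u‖ with hmk
  have hmk0 : 0 < mk := hm k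
  have hmkC : ((mk : ℝ) : ℂ) = ∫ u, G k u := by
    rw [hmk, ← integral_complex_ofReal]
    exact integral_congr_ae (Eventually.of_forall fun u => (hGn k u).symm)
  have hI : ∀ ψ : ℝ → ℂ, Continuous ψ → Integrable (fun u => G k u * ψ u) := fun ψ hψ =>
    ((hGc k).mul hψ).integrable_of_hasCompactSupport hGs.mul_right
  have hdiff : (∫ u, G k u * φ u) / (mk : ℂ) - φ 0 = (∫ u, G k u * (φ u - φ 0)) / (mk : ℂ) := by
    have hmk0' : (mk : ℂ) ≠ 0 := by exact_mod_cast hmk0.ne'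
    have e : (fun u => G k u * (φ u - φ 0)) = fun u => G k u * φ u - G k u * φ 0 := by
      funext u; ring
    rw [e, integral_sub (hI φ hφ) (hI _ continuous_const), integral_mul_const, ← hmkC]
    field_simp
  have hbound : ∀ u, ‖G k u * (φ u - φ 0)‖ ≤ ‖G k u‖ * (ε / 2) := by
    intro u
    rw [norm_mul]
    rcases lt_or_ge |u| η with hu | hu
    · refine mul_le_mul_of_nonneg_left (le_of_lt ?_) (norm_nonneg _)
      have h := hηφ u (by rwa [Real.dist_eq, sub_zero])
      rwa [dist_eq_norm] at h
    · rw [hGδ k u (hδk.trans_le hu)]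
      simp
  have hgi : Integrable (fun u => ‖G k u‖ * (ε / 2)) :=
    ((hGc k).norm.mul continuous_const).integrable_of_hasCompactSupport hGs.norm.mul_right
  have hnorm : ‖∫ u, G k u * (φ u - φ 0)‖ ≤ mk * (ε / 2) := by
    refine (norm_integral_le_of_norm_le hgi (Eventually.of_forall hbound)).trans_eq ?_
    rw [integral_mul_const]
  rw [dist_eq_norm, hdiff, norm_div, Complex.norm_real, Real.norm_of_nonneg hmk0.le]
  calc ‖∫ u, G k u * (φ u - φ 0)‖ / mk ≤ mk * (ε / 2) / mk := by gcongr
    _ = ε / 2 := by field_simp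
    _ < ε := half_lt_self hε

end Summit.RiemannHypothesis.RiemannHypothesis.Theorems.SignConeConeMagnification

end
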